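import Literature.MathematicalPhysics.QuantumFieldTheory.Balaban1983to89.B8Eq184Proof
import Literature.MathematicalPhysics.QuantumFieldTheory.Balaban1983to89.B8Ineq170

/-!
# `Balaban1983to89.B8CfgExpBondLetterRec` — [Balaban1985RegularSpaces] (1.69) p. 88, (1.135)∕(1.138) p. 99: THE FINE-BOND LETTER OF AN EXPONENTIAL CONFIGURATION `U₁ = e^{iηA}` FROM
# ITS LOG ROW — `‖e^{iηA(b)} − 1‖ ≤ η·‖A(b)‖ ≤ r·(Lʲ)⁻¹` when `‖A(b)‖ ≤ r·(Lʲη)⁻¹` (the letter `δ_F` of ✓p761090 `B8PointwiseOscFromFineBondsRec` for the pre-composed crown's `U₁ = c.fixed V um`)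

statement-level skeleton of published theorems with citation tags; proofs where landed; nothing here is a claim about the Yang–Mills mass gap

CITATION HEADER (lean-in-tree rule).  Cell `pub-ymgap` (HUMAN RULING D-0062), seat `pub-ymgap-dag-n07-e` g32 (dag-n07-w3 g13 ASK-5; ⚑ LOCATED-σ1-FACES, cell bus 2026-08-30).
[6] = [Balaban1985RegularSpaces] (1.69) p. 88 (`U₁ = e^{iηA}`), (1.135)∕(1.138) p. 99 («`Lʲη|A| ≤ r` on the sides touching `Ω′_j`»).  `--kind proof --supports stmt-QuantumFields-20541`
(K0⁷; count-neutral; no definition).  REUSED BY NAME: `B8Eq184Proof.cfgExp`, `B7Prop1Explicit.val_expUnit`, `B8Ineq170.norm_exp_I_smul_sub_one_le`.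

WHY.  ✓p761090 turns two fine-bond letters under a cell into the (σ1) pointwise oscillation; the letter of the SMALL field `U₁ = e^{iηA}` is read here from the crown's log row
(`U₁(b) = cfgExp η A b`, `A(b)` self-adjoint, `‖A(b)‖ ≤ r·(Lʲη)⁻¹`): `‖U₁(b) − 1‖ ≤ r·(Lʲ)⁻¹` — uniform under a level-`j` cell, so its share of `ω_u` is `2·d·s·r∕L`.

WHAT IS PROVED (sorry-free).  ★ `norm_cfgExp_sub_one_le_mul_norm` (`‖e^{iηA(b)} − 1‖ ≤ η‖A(b)‖`, `η ≥ 0`, `A(b)` self-adjoint; the linear twin of `B8Prop3GaugeFixedKLevel.norm_cfgExp_sub_one_le`'s constant `1∕8`); ★★ `norm_sub_one_le_of_logRow` (the crown-row reading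
`‖U₁(b) − 1‖ ≤ r·(Lʲ)⁻¹`).
HONEST FRAMING: count-neutral helper (one spectral inequality); nothing of [6] asserted or discharged; the axial letter `δ_W` (face-level (1.35)) is NOT here; `HThm4RecSym152PhiEG` ∕
`HThm4Rec*` UNDISCHARGED; N07 ∕ N05 NOT discharged; K0⁷ ∕ K1⁹ NOT closed; counts unmoved; one finite 𝕋⁴ programme at fixed ε — R4 closes the conditional finite-𝕋⁴ rung
`BalabanLadder.UV` only; the YM mass gap (Clay) is NOT proved by any of this; nothing continuum ∕ ℝ⁴ ∕ OS.  No `def`, no `sorry`, no `instance`, no `notation`.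
-/

set_option autoImplicit false

noncomputable section

namespace Literature.MathematicalPhysics.QuantumFieldTheory.Balaban1983to89.B8CfgExpBondLetterRec

open NormedSpace
open Complex (I)
open B7Prop1Explicit (val_expUnit)
open B8Eq184Proof (cfgExp)

variable {d : ℕ} {𝔸 : Type*} [CStarAlgebra 𝔸]

/-- ★ **`‖e^{iηA(b)} − 1‖ ≤ η·‖A(b)‖`** for `η ≥ 0` and `A(b)` self-adjoint (spectral bound `|e^{it} − 1| ≤ |t|`). [cite: Balaban1985RegularSpaces, (1.69) p.88, (1.135) p.99] -/
theorem norm_cfgExp_sub_one_le_mul_norm {η : ℝ} (hη : 0 ≤ η) (A : B7Prop1Explicit.Site d → Fin d → 𝔸) (x : B7Prop1Explicit.Site d) (μ : Fin d) (hsa : IsSelfAdjoint (A x μ)) :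
    ‖((cfgExp η A x μ : 𝔸ˣ) : 𝔸) - 1‖ ≤ η * ‖A x μ‖ := by
  have hsa' : IsSelfAdjoint (η • A x μ) := (IsSelfAdjoint.smul (IsSelfAdjoint.all η) hsa : IsSelfAdjoint _)
  have h := B8Ineq170.norm_exp_I_smul_sub_one_le hsa'
  rw [norm_smul, Real.norm_of_nonneg hη] at h
  simpa [cfgExp, val_expUnit] using h

/-- ★★ **THE CROWN-ROW READING** ([6] (1.135)∕(1.138): «`U₁ = e^{iηA}`, `Lʲη|A(b)| ≤ r` on the sides touching `Ω′_j`»): if `U₁(b) = cfgExp η A b` with `A(b)` self-adjoint and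
`‖A(b)‖ ≤ r·(Lʲη)⁻¹` (`η > 0`, `Lʲ > 0`), then `‖U₁(b) − 1‖ ≤ r·(Lʲ)⁻¹` — the fine-bond letter `δ_F` of ✓p761090, uniform under a level-`j` cell.
[cite: Balaban1985RegularSpaces, (1.69) p.88, (1.135) p.99, (1.138) p.99] -/
theorem norm_sub_one_le_of_logRow {η : ℝ} (hη : 0 < η) {U₁ : B7Prop1Explicit.Site d → Fin d → 𝔸ˣ} {A : B7Prop1Explicit.Site d → Fin d → 𝔸} {x : B7Prop1Explicit.Site d} {μ : Fin d}
    (heq : U₁ x μ = cfgExp η A x μ) (hsa : IsSelfAdjoint (A x μ)) {r Lj : ℝ} (hLj : 0 < Lj) (hA : ‖A x μ‖ ≤ r * (Lj * η)⁻¹) :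
    ‖((U₁ x μ : 𝔸ˣ) : 𝔸) - 1‖ ≤ r * Lj⁻¹ := by
  rw [heq]
  refine (norm_cfgExp_sub_one_le_mul_norm hη.le A x μ hsa).trans ?_
  calc η * ‖A x μ‖ ≤ η * (r * (Lj * η)⁻¹) := mul_le_mul_of_nonneg_left hA hη.le
    _ = r * Lj⁻¹ := by field_simp

end Literature.MathematicalPhysics.QuantumFieldTheory.Balaban1983to89.B8CfgExpBondLetterRec

end
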